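import Summits.Parity.GeneralizedHardyLittlewood.Theorems.BeyondDiagonalBeatsQuarter.KernelFormXSqBridge
import HarnessLib

/-!
# Route `PrimeLevelFamEdge`, crux K_A `MomentsBeyondDiagonal` (stmt-Parity-20007), line «petersson_layers» v4, stub `stub_diag`:
# **tools for the log-decorated sums (census R3(ii), analytic half — first reductions)**

After `…DiagLineDecorated.sum_mollifierCoeff_hecke_eq_decorated` the general-`Q` diagonal is a combination of Selberg-type
sums whose coefficients carry LOG-DECORATIONS: powers of `log k` and the divisor-log sums
`τ_{α,β}(k) = Σ_{d∣k}(log d)^α(log(k/d))^β`, which for squarefree `k` are `τ(k)`-multiples of polynomials in `log k` and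
the additive prime sums `P_j(k) = Σ_{p∣k}(log p)^j`. This file records the three elementary reductions that make the
existing UNdecorated engines (`KernelFormXSqCore`, `…DiagCoprime`, `…DiagPrimeSum`) applicable:

* `sum_mul_log_pow_mul_log_div_pow_eq` — **decorations in `log k` are free**: for `y > 0`,
  `Σ_{k≤y} a_k (log k)^α log^c(y/k) = Σ_{β≤α} C(α,β)(log y)^{α−β}(−1)^β Σ_{k≤y} a_k log^{c+β}(y/k)` (binomial theorem,
  `log k = log y − log(y/k)`);
* `sum_divisors_log_eq` — `Σ_{d∣k} log d = ½τ(k)·log k` (`d ↔ k/d`), i.e. `τ_{1,0} = τ_{0,1} = ½τ·log`;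
* `sum_mul_sum_primeFactors_eq` — **removing an additive prime decoration**: `Σ_{k≤N} F(k)·Σ_{p∣k} g(p) =
  Σ_{p≤N prime} g(p)·Σ_{k'≤N/p} F(pk')` — with `F = copTauW n·G` this is a prime sum of undecorated sums at `y/p`
  (the structure already handled by `…DiagPrimeCoupling`).

Def-free; theorems only. Helper `--supports stmt-Parity-20007`; closes nothing; K_A, K_B and the Parity summit are NOT
proved; nothing about Landau–Siegel zeros.

## References
* E. Kowalski, P. Michel, J. VanderKam, J. reine angew. Math. 526 (2000), (23)–(28) pp. 13–15 (the residue polynomials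
  of the diagonal, general `Q`). [cite: KowalskiMichelVanderKam2000, (23)–(28) — derivation (bookkeeping of log-decorations)]
-/

noncomputable section

open Finset

namespace Summit.Parity.GeneralizedHardyLittlewood.Theorems.MomentsBeyondDiagonal.DiagLines

open Summit.Parity.GeneralizedHardyLittlewood.Theorems.BeyondDiagonalBeatsQuarter.KernelFormXSq (sum_Icc_ite_dvd_eq)

/-! ### Decorations in `log k` are free -/

/-- **Decorations in `log k` are free.** For `y > 0`, any coefficients `a` and exponents `α, c`:
`Σ_{k≤y} a_k·(log k)^α·log^c(y/k) = Σ_{β≤α} C(α,β)·(log y)^{α−β}·(−1)^β·Σ_{k≤y} a_k·log^{c+β}(y/k)`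
(`log k = log y − log(y/k)` for `k ≥ 1`, binomial theorem). [folklore] -/
theorem sum_mul_log_pow_mul_log_div_pow_eq {y : ℝ} (hy : 0 < y) (a : ℕ → ℝ) (α c : ℕ) :
    ∑ k ∈ Icc 1 ⌊y⌋₊, a k * Real.log k ^ α * Real.log (y / k) ^ c =
      ∑ β ∈ Finset.range (α + 1), (α.choose β : ℝ) * Real.log y ^ (α - β) * (-1) ^ β *
        ∑ k ∈ Icc 1 ⌊y⌋₊, a k * Real.log (y / k) ^ (c + β) := by
  -- pointwise: `(log k)^α = (log y − log(y/k))^α = Σ_β C(α,β)(log y)^{α−β}(−log(y/k))^β`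
  have hpt : ∀ k ∈ Icc 1 ⌊y⌋₊, a k * Real.log k ^ α * Real.log (y / k) ^ c =
      ∑ β ∈ Finset.range (α + 1), (α.choose β : ℝ) * Real.log y ^ (α - β) * (-1) ^ β *
        (a k * Real.log (y / k) ^ (c + β)) := by
    intro k hk
    have hk0 : (0 : ℝ) < k := by exact_mod_cast (Finset.mem_Icc.1 hk).1
    have hlog : Real.log k = -Real.log (y / k) + Real.log y := by
      rw [Real.log_div hy.ne' hk0.ne']; ring
    rw [hlog, add_pow, Finset.mul_sum, Finset.sum_mul]
    refine Finset.sum_congr rfl fun β _ ↦ ?_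
    rw [neg_pow, pow_add]
    ring
  rw [Finset.sum_congr rfl hpt, Finset.sum_comm]
  refine Finset.sum_congr rfl fun β _ ↦ ?_
  rw [Finset.mul_sum]

/-! ### `Σ_{d ∣ k} log d = ½ τ(k) log k` -/

/-- **`Σ_{d∣k} log d = ½·τ(k)·log k`** for `k ≥ 1` (pair `d ↔ k/d`: `log d + log(k/d) = log k`). [folklore] -/
theorem sum_divisors_log_eq {k : ℕ} (hk : k ≠ 0) :
    ∑ d ∈ k.divisors, Real.log d = (k.divisors.card : ℝ) * Real.log k / 2 := by
  have hswap : ∑ d ∈ k.divisors, Real.log d = ∑ d ∈ k.divisors, Real.log ((k / d : ℕ) : ℝ) :=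
    (Nat.sum_div_divisors k (fun d ↦ Real.log (d : ℝ))).symm
  have hsum : ∑ d ∈ k.divisors, (Real.log d + Real.log ((k / d : ℕ) : ℝ)) =
      ∑ d ∈ k.divisors, Real.log k := by
    refine Finset.sum_congr rfl fun d hd ↦ ?_
    have hd' := (Nat.mem_divisors.1 hd).1
    have hd0 : d ≠ 0 := by rintro rfl; exact hk (zero_dvd_iff.1 hd')
    have hkd0 : k / d ≠ 0 := (Nat.div_ne_zero_iff_of_dvd hd').2 ⟨hk, hd0⟩
    rw [← Real.log_mul (by exact_mod_cast hd0) (by exact_mod_cast hkd0)]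
    congr 1
    exact_mod_cast Nat.mul_div_cancel' hd'
  have h2 : 2 * ∑ d ∈ k.divisors, Real.log d = (k.divisors.card : ℝ) * Real.log k := by
    rw [two_mul]
    conv_lhs => rw [hswap]; arg 1; rw [← hswap]
    rw [← Finset.sum_add_distrib, hsum, Finset.sum_const, nsmul_eq_mul]
  linarith

/-! ### Removing an additive prime decoration -/

/-- **`Σ_{k≤N} F(k)·Σ_{p∣k} g(p) = Σ_{p ≤ N prime} g(p)·Σ_{k'≤N/p} F(pk')`** (exchange `Σ_k Σ_{p∣k}` and reindex the
multiples of `p`). [folklore] -/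
theorem sum_mul_sum_primeFactors_eq (N : ℕ) (F g : ℕ → ℝ) :
    ∑ k ∈ Icc 1 N, F k * ∑ p ∈ k.primeFactors, g p =
      ∑ p ∈ (Icc 1 N).filter Nat.Prime, g p * ∑ k ∈ Icc 1 (N / p), F (p * k) := by
  set P := (Icc 1 N).filter Nat.Prime with hP
  have h1 : ∑ k ∈ Icc 1 N, F k * ∑ p ∈ k.primeFactors, g p =
      ∑ p ∈ P, ∑ k ∈ (Icc 1 N).filter (fun k ↦ p ∣ k), g p * F k := by
    have hre : ∀ k ∈ Icc 1 N, F k * ∑ p ∈ k.primeFactors, g p = ∑ p ∈ k.primeFactors, g p * F k := by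
      intro k _
      rw [Finset.mul_sum]
      exact Finset.sum_congr rfl fun p _ ↦ by ring
    rw [Finset.sum_congr rfl hre]
    refine Finset.sum_comm' fun k p ↦ ?_
    simp only [hP, Finset.mem_filter, Finset.mem_Icc, Nat.mem_primeFactors]
    constructor
    · rintro ⟨⟨hk1, hkN⟩, hp, hpk, hk0⟩
      exact ⟨⟨⟨hk1, hkN⟩, hpk⟩, ⟨hp.one_lt.le, (Nat.le_of_dvd (by omega) hpk).trans hkN⟩, hp⟩
    · rintro ⟨⟨⟨hk1, hkN⟩, hpk⟩, ⟨-, -⟩, hp⟩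
      exact ⟨⟨hk1, hkN⟩, hp, hpk, by omega⟩
  rw [h1]
  refine Finset.sum_congr rfl fun p hp ↦ ?_
  have hp' : p.Prime := (Finset.mem_filter.1 hp).2
  rw [Finset.sum_filter, sum_Icc_ite_dvd_eq hp'.ne_zero N (fun k ↦ g p * F k), ← Finset.mul_sum]

end Summit.Parity.GeneralizedHardyLittlewood.Theorems.MomentsBeyondDiagonal.DiagLines

end
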